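import Mathlib
import HarnessLib
import Summits.AtomisticToContinuum.Crystallization.Theorems.PricedLinkCensusSoftFourRingsRigModels
import Summits.AtomisticToContinuum.Crystallization.Theorems.PricedLinkCensusSoftFourRingsRigDataFcc1
import Summits.AtomisticToContinuum.Crystallization.Theorems.PricedLinkCensusSoftFourRingsRigDataFcc2
import Summits.AtomisticToContinuum.Crystallization.Theorems.PricedLinkCensusSoftFourRingsRigDataHcp1
import Summits.AtomisticToContinuum.Crystallization.Theorems.PricedLinkCensusSoftFourRingsRigDataHcp2

/-!
# Soft four-rings, metric half by certified numerics (11): the decoded certificate cells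

Route `PricedLinkCensus`, sub-problem `Crystallization`, item `SoftFourRings`
(stmt-AtomisticToContinuum-14234).  The decoded FCC / HCP certificate cells (`decodeCell` of `…RigModels` applied to the base64 data of `…RigData{Fcc,Hcp}{1,2}`), shared by the three check files `…RigCheck*` and `…RigMain`.
-/

namespace Summit.AtomisticToContinuum.Crystallization.Theorems

namespace Rig

/-- The decoded FCC cells (the `x ≥ 0` chart, then the `x ≤ 0` chart; each ascending in the free parameter). -/
def fccCells : List Cell := (fccData1 ++ fccData2).toList.map decodeCell

/-- The decoded HCP cells (the `x ≥ 0` chart, then the `x ≤ 0` chart; each ascending in the free parameter). -/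
def hcpCells : List Cell := (hcpData1 ++ hcpData2).toList.map decodeCell

end Rig

end Summit.AtomisticToContinuum.Crystallization.Theorems
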